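import Summits.QuantumFields.BalabanUV.Beta.KernelPermutation
import Literature.MathematicalPhysics.QuantumFieldTheory.Balaban1983to89.Beta.ResolventReflection

/-!
# `BalabanUV.Beta.ResolventPermutation` — road «FP» for binder row D1, row PERM-COV, MODULE 2: THE AXIS PERMUTATIONS ACT ON THE TYPED
# ONE-STEP SYSTEM — the packed resolvent `KInv N` is PERMUTATION-INVARIANT (`permK (axisPerm σ) (KInv N) = KInv N`), by transport of the
# `U = 1` KKT system and UNIQUENESS of its tempered solutions (the `Equiv.Perm (Fin (d+1))` twin of `Beta.ResolventReflection` §1–§4)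

HONEST FRAMING (cell contract, verbatim): «discharging `BetaPertH` makes Bałaban's UV stability UNCONDITIONAL — a real constructive-QFT
result; it is NOT the continuum limit and NOT the Clay problem.»  THIS MODULE DISCHARGES NOTHING of `BetaPertH` / row D1: [folklore] transport of
structure (a lattice automorphism acting on forms, block sums, contour sums) + linearity and UNIQUENESS of tempered solutions of the typed `U = 1`
Karush–Kuhn–Tucker system (`Beta.KKTFluctuationUnique`) + finite re-indexing — an5's `ResolventReflection` method with the block-compatible
reflection `sref α` replaced by the axis permutation `psite σ : x ↦ x ∘ σ⁻¹` (MODULE 1 `Beta.KernelPermutation`).  The permutation case is SIGN-FREE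
and fixes the origin, the coarse sublattice and every block (blocks are cubes), so no re-basing and no block translate appear.
CONTENT ([folklore], 0 sorry, 0 `def … : Prop`, nothing cited):
* §1 pull-backs of forms `P0 σ f := f ∘ (σ•·)`, `P1 σ A κ := A (σ κ) ∘ (σ•·)`, `P2 σ F κ l := F (σ κ) (σ l) ∘ (σ•·)`; `psite_unitVec : σ•e_κ = e_{σ κ}`.
* §2 commutation with EVERY operator of the typed `U = 1` system: `dz_P0`, `codiff₁_P1`, `curv_P1`, `curvAdj_P2`, box re-indexing (`sum_box_psite`,
  `psite_block`), `blockSum_P0`, `isBlockConst_P0`, `contourSum_P1`, `quo_psite`, `contourSumAdj_P1`, `proj_psite_eq_zero_iff`.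
* §3 TRANSPORT `solvesKKT_perm` (+ temperedness `tempered1_P1` ∕ `tempered0_P0`, `ℓ¹`-isometry).
* §4 **`Gam_perm`** ∕ **`wH_perm`**: the pulled-back covariance ∕ minimiser columns at the permuted source are the columns at the source
  (`KKTFluctuationUnique.eq_Gam_of_solvesKKT` ∕ `unique_of_solvesKKT`); pointwise `Gam_psite`, `GamΦ_psite`, `wH_psite`, `wΦ_psite`; and
  **`permK_KInv : permK (axisPerm σ) (KInv N) = KInv N`** — every `σ`, every `N ≥ 1`, any dimension; no formula for the kernels is used.
MODULE 3 (`Beta.ResolventPermutationStep`): decimation `permK_dec`, `permK_KInvStep`, and `B12Beta.PermCovariant (flipK (TbalOf Lc Js j))` from jet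
covariance.  Unit `b2b-balaban-beta-d1-formalise-leaf-01` (gen 7), 2026-08-20; claim table `HOME/b2b-balaban-beta-d1-p3/LEAVES-FP.md` sub-row PERM-COV.
HONEST DEPENDENCY (verbatim): «continuum YM on T⁴ ⇐ BetaPertH ∧ nine spine estimates (0/9 proved); BetaPertH ⇐ (D1) ∧ (D4) ∧ CAP+tail;
G-an2-4 gates asym, D1 and NE2/3/4.»  ABSOLUTE RULE (cell, verbatim): «No internally-minted statement may enter as a cited fact. Every
hypothesis is either kernel-proved in this package or a verbatim quotation of a PUBLISHED theorem with page reference.»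
-/

namespace Summit.QuantumFields.BalabanUV.Beta.ResolventPermutation

noncomputable section

open Finset
open scoped BigOperators
open Literature.Probability.LatticeModels (TorusSite Torus.proj Torus.proj_apply)
open Literature.MathematicalPhysics.QuantumFieldTheory.Balaban1983to89
open Literature.MathematicalPhysics.QuantumFieldTheory.Balaban1983to89.Beta
open AffineAveraging (Form0 Form1 Form2 unitVec unitVec_apply dz curv curvAdj codiff₁ box toSite blockSum contourSum)
open AffineReproduction (contourSumAdj IsBlockConst)
open Literature.MathematicalPhysics.QuantumFieldTheory.LatticeForm (quo)
open KKTFluctuationUnique (SolvesKKT Tempered0 Tempered1 unique_of_solvesKKT eq_Gam_of_solvesKKT solvesKKT_Gam solvesKKT_wH tempered_Gam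
  tempered_GamΦ tempered_GamM)
open KKTFluctuationKernel (Gam GamΦ GamM delta1 delta1_apply)
open KernelSpecInstance (wH wΦ wM)
open OneStepResolventKernel (Fib KInv KInv_inl_inl KInv_inl_inr_coarse KInv_inr_inl_coarse KInv_inr_inr_coarse KInv_inl_inr_off KInv_inr_off
  eq_zsmul_quo_of_proj)
open ResolventReflection (mem_box toSite_apply contourSumAdj_eq solvesKKT_congr tempered_wH tempered_wΦ tempered_wM)
open B12Sec2to5 (l1 l1_nonneg)
open Summit.QuantumFields.BalabanUV.Beta.KernelPermutation

variable {D : ℕ}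

/-! ## §1 The axis permutation acting on forms -/

/-- [folklore] `σ•e_κ = e_{σ κ}`. -/
theorem psite_unitVec (σ : Equiv.Perm (Fin D)) (κ : Fin D) : psite σ (unitVec κ) = unitVec (σ κ) := by
  funext i
  simp only [psite_apply, unitVec_apply]
  by_cases h : i = σ κ
  · subst h; simp
  · have h' : σ.symm i ≠ κ := fun e => h (by rw [← e, Equiv.apply_symm_apply])
    simp [h, h']

/-- [folklore] PULLBACK OF 0-FORMS. -/
def P0 (σ : Equiv.Perm (Fin D)) (f : Form0 D ℝ) : Form0 D ℝ := fun x => f (psite σ x)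

/-- [folklore] PULLBACK OF 1-FORMS: the `κ`-bond at `x` is read as the `σ κ`-bond at `σ•x` (no orientation sign, no re-basing). -/
def P1 (σ : Equiv.Perm (Fin D)) (A : Form1 D ℝ) : Form1 D ℝ := fun κ x => A (σ κ) (psite σ x)

/-- [folklore] PULLBACK OF 2-FORMS. -/
def P2 (σ : Equiv.Perm (Fin D)) (F : Form2 D ℝ) : Form2 D ℝ := fun κ l x => F (σ κ) (σ l) (psite σ x)

/-- [folklore] Entries of the pulled-back scalar. -/
@[simp] theorem P0_apply (σ : Equiv.Perm (Fin D)) (f : Form0 D ℝ) (x : Fin D → ℤ) : P0 σ f x = f (psite σ x) := rfl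
/-- [folklore] Entries of the pulled-back 1-form. -/
@[simp] theorem P1_apply (σ : Equiv.Perm (Fin D)) (A : Form1 D ℝ) (κ : Fin D) (x : Fin D → ℤ) : P1 σ A κ x = A (σ κ) (psite σ x) := rfl
/-- [folklore] Entries of the pulled-back 2-form. -/
@[simp] theorem P2_apply (σ : Equiv.Perm (Fin D)) (F : Form2 D ℝ) (κ l : Fin D) (x : Fin D → ℤ) :
    P2 σ F κ l x = F (σ κ) (σ l) (psite σ x) := rfl

/-- [folklore] The 1-form pull-back of `0`. -/
theorem P1_zero (σ : Equiv.Perm (Fin D)) : P1 σ (0 : Form1 D ℝ) = 0 := rfl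
/-- [folklore] The 1-form pull-back is homogeneous. -/
theorem P1_smul (σ : Equiv.Perm (Fin D)) (a : ℝ) (A : Form1 D ℝ) : P1 σ (a • A) = a • P1 σ A := rfl
/-- [folklore] The scalar pull-back is homogeneous. -/
theorem P0_smul (σ : Equiv.Perm (Fin D)) (a : ℝ) (f : Form0 D ℝ) : P0 σ (a • f) = a • P0 σ f := rfl

/-! ## §2 Covariance of the lattice operators of the `U = 1` KKT system -/

/-- [folklore] `d` on 0-forms commutes with the axis permutation. -/
theorem dz_P0 (σ : Equiv.Perm (Fin D)) (f : Form0 D ℝ) : dz (P0 σ f) = P1 σ (dz f) := by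
  funext κ x
  simp only [dz, P0_apply, P1_apply, psite_add, psite_unitVec]

/-- [folklore] `δ` on 1-forms commutes with the axis permutation. -/
theorem codiff₁_P1 (σ : Equiv.Perm (Fin D)) (A : Form1 D ℝ) : codiff₁ (P1 σ A) = P0 σ (codiff₁ A) := by
  funext x
  simp only [codiff₁, P0_apply, P1_apply, psite_sub, psite_unitVec]
  exact Equiv.sum_comp σ (fun κ => A κ (psite σ x - unitVec κ) - A κ (psite σ x))

/-- [folklore] The curvature commutes with the axis permutation. -/
theorem curv_P1 (σ : Equiv.Perm (Fin D)) (A : Form1 D ℝ) : curv (P1 σ A) = P2 σ (curv A) := by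
  funext κ l x
  simp only [curv, P1_apply, P2_apply, psite_add, psite_unitVec]

/-- [folklore] The adjoint curvature commutes with the axis permutation. -/
theorem curvAdj_P2 (σ : Equiv.Perm (Fin D)) (G : Form2 D ℝ) : curvAdj (P2 σ G) = P1 σ (curvAdj G) := by
  funext μ y
  simp only [curvAdj, P1_apply, P2_apply, psite_sub, psite_unitVec]
  congr 1
  · exact Equiv.sum_comp σ (fun l => G (σ μ) l (psite σ y) - G (σ μ) l (psite σ y - unitVec l))
  · exact Equiv.sum_comp σ (fun κ => G κ (σ μ) (psite σ y - unitVec κ) - G κ (σ μ) (psite σ y))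

/-! ### Box reindexing -/

/-- [folklore] The permuted offset stays in the box (boxes are cubes). -/
theorem psite_mem_box (σ : Equiv.Perm (Fin D)) {L : ℕ} {b : Fin D → ℕ} (hb : b ∈ box D L) : psite σ b ∈ box D L := by
  rw [mem_box] at hb ⊢
  exact fun i => hb _

/-- [folklore] Reindexing a box sum by the offset permutation. -/
theorem sum_box_psite {M : Type*} [AddCommMonoid M] (σ : Equiv.Perm (Fin D)) (L : ℕ) (g : (Fin D → ℕ) → M) :
    ∑ b ∈ box D L, g (psite σ b) = ∑ b ∈ box D L, g b :=
  Finset.sum_nbij' (psite σ) (psite σ⁻¹) (fun _ hb => psite_mem_box σ hb) (fun _ hb => psite_mem_box σ⁻¹ hb)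
    (fun b _ => psite_inv_psite σ b) (fun b _ => psite_psite_inv σ b) (fun _ _ => rfl)

/-- [folklore] The offset permutation read as a site. -/
theorem toSite_psite (σ : Equiv.Perm (Fin D)) (b : Fin D → ℕ) : toSite (psite σ b) = psite σ (toSite b) := rfl

/-- [folklore] The permutation maps the block of `y` onto the block of `σ•y`, offsets permuted. -/
theorem psite_block (σ : Equiv.Perm (Fin D)) (L : ℕ) (b : Fin D → ℕ) (y : Fin D → ℤ) :
    psite σ ((L : ℤ) • y + toSite b) = (L : ℤ) • psite σ y + toSite (psite σ b) := rfl

/-- [folklore] Block sums commute with the axis permutation. -/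
theorem blockSum_P0 (σ : Equiv.Perm (Fin D)) (L : ℕ) (f : Form0 D ℝ) : blockSum L (P0 σ f) = P0 σ (blockSum L f) := by
  funext y
  simp only [blockSum, P0_apply]
  rw [← sum_box_psite σ L (fun b => f ((L : ℤ) • psite σ y + toSite b))]
  rfl

/-- [folklore] Block-constancy is preserved by the axis permutation. -/
theorem isBlockConst_P0 (σ : Equiv.Perm (Fin D)) {L : ℕ} {g : Form0 D ℝ} (hg : IsBlockConst L g) : IsBlockConst L (P0 σ g) := by
  intro y b hb
  simp only [P0_apply]
  rw [psite_block, hg _ _ (psite_mem_box σ hb), psite_smul]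

/-- [folklore] Straight-contour block sums commute with the axis permutation (offsets permuted, steps along `σ κ`). -/
theorem contourSum_P1 (σ : Equiv.Perm (Fin D)) (L : ℕ) (A : Form1 D ℝ) : contourSum L (P1 σ A) = P1 σ (contourSum L A) := by
  funext κ y
  simp only [contourSum, P1_apply]
  rw [← sum_box_psite σ L (fun b => ∑ s ∈ Finset.range L, A (σ κ) ((L : ℤ) • psite σ y + toSite b + (s : ℤ) • unitVec (σ κ)))]
  refine Finset.sum_congr rfl fun b _ => Finset.sum_congr rfl fun s _ => ?_
  rw [psite_add, psite_block, psite_smul, psite_unitVec]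

/-! ### The adjoint block-average operator `𝒬ᵀ` and the coarse sublattice -/

/-- [folklore] Block indices commute with the axis permutation: `quo N ∘ (σ•·) = (σ•·) ∘ quo N`. -/
theorem quo_psite (σ : Equiv.Perm (Fin D)) (N : ℕ) (z : Fin D → ℤ) : quo N (psite σ z) = psite σ (quo N z) := rfl

/-- [folklore] `𝒬ᵀ` commutes with the axis permutation. -/
theorem contourSumAdj_P1 (σ : Equiv.Perm (Fin D)) (N : ℕ) (φ : Form1 D ℝ) : contourSumAdj N (P1 σ φ) = P1 σ (contourSumAdj N φ) := by
  funext κ x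
  simp only [P1_apply, contourSumAdj_eq]
  refine Finset.sum_congr rfl fun s _ => ?_
  rw [← quo_psite, psite_sub, psite_smul, psite_unitVec]

/-- [folklore] Residues commute with the axis permutation. -/
theorem proj_psite (σ : Equiv.Perm (Fin D)) (N : ℕ) (x : Fin D → ℤ) : Torus.proj N (psite σ x) = psite σ (Torus.proj N x) := rfl

/-- [folklore] The axis permutation preserves (non-)membership in the coarse sublattice. -/
theorem proj_psite_eq_zero_iff (σ : Equiv.Perm (Fin D)) (N : ℕ) (x : Fin D → ℤ) : Torus.proj N (psite σ x) = 0 ↔ Torus.proj N x = 0 := by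
  rw [proj_psite]
  constructor
  · intro h
    have := congrArg (psite σ⁻¹) h
    rwa [psite_inv_psite, psite_zero] at this
  · intro h
    rw [h, psite_zero]

/-! ## §3 Transport of the KKT system; temperedness -/

section Transport

variable {d N : ℕ}

/-- [folklore] **THE `U = 1` KKT SYSTEM IS PERMUTATION-COVARIANT**: the pulled-back triple solves the system with the pulled-back force and
the pulled-back block averages. -/
theorem solvesKKT_perm (σ : Equiv.Perm (Fin (d + 1))) {F c A φ : Form1 (d + 1) ℝ} {μ : Form0 (d + 1) ℝ} (h : SolvesKKT N F c A φ μ) :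
    SolvesKKT N (P1 σ F) (P1 σ c) (P1 σ A) (P1 σ φ) (P0 σ μ) where
  el κ x := by
    have e1 : curvAdj (curv (P1 σ A)) = P1 σ (curvAdj (curv A)) := by rw [curv_P1, curvAdj_P2]
    have e2 : dz (codiff₁ (dz (P0 σ μ))) = P1 σ (dz (codiff₁ (dz μ))) := by rw [dz_P0, codiff₁_P1, dz_P0]
    rw [e1, e2, contourSumAdj_P1]
    simp only [P1_apply]
    exact h.el _ _
  gauge := by
    have e : codiff₁ (dz (codiff₁ (P1 σ A))) = P0 σ (codiff₁ (dz (codiff₁ A))) := by rw [codiff₁_P1, dz_P0, codiff₁_P1]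
    rw [e]
    exact isBlockConst_P0 σ h.gauge
  mean y := by
    rw [blockSum_P0]
    exact h.mean _
  avg κ y := by
    rw [contourSum_P1]
    exact h.avg _ _

/-- [folklore] Temperedness is preserved by the axis permutation (1-forms; same constants, `ℓ¹`-isometry). -/
theorem tempered1_P1 (σ : Equiv.Perm (Fin (d + 1))) {A : Form1 (d + 1) ℝ} (hA : Tempered1 A) : Tempered1 (P1 σ A) := by
  obtain ⟨C, m, hC⟩ := hA
  exact ⟨C, m, fun κ x => by rw [P1_apply, ← l1_psite σ x]; exact hC _ _⟩

/-- [folklore] Temperedness is preserved by the axis permutation (0-forms). -/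
theorem tempered0_P0 (σ : Equiv.Perm (Fin (d + 1))) {f : Form0 (d + 1) ℝ} (hf : Tempered0 f) : Tempered0 (P0 σ f) := by
  obtain ⟨C, m, hC⟩ := hf
  exact ⟨C, m, fun x => by rw [P0_apply, ← l1_psite σ x]; exact hC _⟩

end Transport

/-! ## §4 Permutation covariance of the KKT columns and invariance of the packed resolvent -/

section Resolvent

variable {d N : ℕ} [NeZero N]

/-- [folklore] The pulled-back unit force at the permuted source is the unit force at the source: `P1 σ (δ_{(σ l, σ•x′)}) = δ_{(l, x′)}`. -/
theorem P1_delta1 (σ : Equiv.Perm (Fin (d + 1))) (l : Fin (d + 1)) (x' : Fin (d + 1) → ℤ) :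
    P1 σ (delta1 (σ l) (psite σ x')) = delta1 l x' := by
  funext κ x
  simp only [P1_apply, delta1_apply, EmbeddingLike.apply_eq_iff_eq, (psite σ).injective.eq_iff]

/-- [folklore] **PERMUTATION COVARIANCE OF THE FLUCTUATION COVARIANCE COLUMNS** (`Γ`, `Φ`, `M` of `Beta/KKTFluctuationKernel`): the pulled-back
column at the permuted source bond `(σ l, σ•x′)` is the column at `(l, x′)` — by the uniqueness of tempered solutions. -/
theorem Gam_perm (σ : Equiv.Perm (Fin (d + 1))) (l : Fin (d + 1)) (x' : Fin (d + 1) → ℤ) :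
    (P1 σ (fun κ x => Gam (N := N) κ x (σ l) (psite σ x')) = fun κ x => Gam (N := N) κ x l x') ∧
    (P1 σ (fun κ q => GamΦ (N := N) κ q (σ l) (psite σ x')) = fun κ q => GamΦ (N := N) κ q l x') ∧
    (P0 σ (fun z => GamM (N := N) z (σ l) (psite σ x')) = fun z => GamM (N := N) z l x') := by
  have h1 := solvesKKT_perm σ (solvesKKT_Gam (N := N) (σ l) (psite σ x'))
  have h2 : SolvesKKT N (delta1 l x') 0 (P1 σ fun κ x => Gam (N := N) κ x (σ l) (psite σ x'))
      (P1 σ fun κ q => GamΦ (N := N) κ q (σ l) (psite σ x')) (P0 σ fun z => GamM (N := N) z (σ l) (psite σ x')) :=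
    solvesKKT_congr (P1_delta1 σ l x') (P1_zero σ) h1
  exact eq_Gam_of_solvesKKT h2 (tempered1_P1 σ (tempered_Gam _ _)) (tempered1_P1 σ (tempered_GamΦ _ _))
    (tempered0_P0 σ (tempered_GamM _ _))

/-- [folklore] Pointwise form of `Gam_perm` for `Γ`: `Γ_{(σκ, σ•x),(σl, σ•x′)} = Γ_{(κ,x),(l,x′)}`. -/
theorem Gam_psite (σ : Equiv.Perm (Fin (d + 1))) (κ l : Fin (d + 1)) (x x' : Fin (d + 1) → ℤ) :
    Gam (N := N) (σ κ) (psite σ x) (σ l) (psite σ x') = Gam (N := N) κ x l x' := by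
  have h := congrFun (congrFun (Gam_perm (N := N) σ l x').1 κ) x
  simpa only [P1_apply] using h

/-- [folklore] Pointwise form of `Gam_perm` for `Φ = GamΦ`. -/
theorem GamΦ_psite (σ : Equiv.Perm (Fin (d + 1))) (κ l : Fin (d + 1)) (q x' : Fin (d + 1) → ℤ) :
    GamΦ (N := N) (σ κ) (psite σ q) (σ l) (psite σ x') = GamΦ (N := N) κ q l x' := by
  have h := congrFun (congrFun (Gam_perm (N := N) σ l x').2.1 κ) q
  simpa only [P1_apply] using h

/-- [folklore] **PERMUTATION COVARIANCE OF THE MINIMISER COLUMNS** (`wH`, `wΦ`, `wM` of `Beta/KernelSpecInstance`): the pulled-back column `σ l` is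
the column `l` (the permutation fixes the origin, so no block translate appears) — by the uniqueness of tempered solutions. -/
theorem wH_perm (σ : Equiv.Perm (Fin (d + 1))) (l : Fin (d + 1)) :
    (P1 σ (fun κ z => wH (N := N) κ (σ l) z) = fun κ z => wH (N := N) κ l z) ∧
    (P1 σ (fun κ y => wΦ (N := N) κ (σ l) y) = fun κ y => wΦ (N := N) κ l y) ∧
    (P0 σ (wM (N := N) (σ l)) = wM (N := N) l) := by
  have h1 := solvesKKT_perm σ (solvesKKT_wH (N := N) (σ l))
  have hc : P1 σ (fun κ y => if y = 0 ∧ κ = σ l then (1 : ℝ) else 0) = fun κ y => if y = 0 ∧ κ = l then (1 : ℝ) else 0 := by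
    funext κ y
    simp only [P1_apply, EmbeddingLike.apply_eq_iff_eq, psite_eq_zero_iff]
  have h2 : SolvesKKT N 0 (fun κ y => if y = 0 ∧ κ = l then (1 : ℝ) else 0) (P1 σ fun κ z => wH (N := N) κ (σ l) z)
      (P1 σ fun κ y => wΦ (N := N) κ (σ l) y) (P0 σ (wM (N := N) (σ l))) :=
    solvesKKT_congr (P1_zero σ) hc h1
  exact unique_of_solvesKKT h2 (solvesKKT_wH (N := N) l) (tempered1_P1 σ (tempered_wH _)) (tempered1_P1 σ (tempered_wΦ _))
    (tempered0_P0 σ (tempered_wM _)) (tempered_wH l) (tempered_wΦ l) (tempered_wM l)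

/-- [folklore] Pointwise form of `wH_perm` for `wH`. -/
theorem wH_psite (σ : Equiv.Perm (Fin (d + 1))) (κ l : Fin (d + 1)) (z : Fin (d + 1) → ℤ) :
    wH (N := N) (σ κ) (σ l) (psite σ z) = wH (N := N) κ l z := by
  have h := congrFun (congrFun (wH_perm (N := N) σ l).1 κ) z
  simpa only [P1_apply] using h

/-- [folklore] Pointwise form of `wH_perm` for `wΦ`. -/
theorem wΦ_psite (σ : Equiv.Perm (Fin (d + 1))) (κ l : Fin (d + 1)) (y : Fin (d + 1) → ℤ) :
    wΦ (N := N) (σ κ) (σ l) (psite σ y) = wΦ (N := N) κ l y := by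
  have h := congrFun (congrFun (wH_perm (N := N) σ l).2.1 κ) y
  simpa only [P1_apply] using h

/-- [folklore] **THE PACKED RESOLVENT IS PERMUTATION-INVARIANT**: `permK (axisPerm σ) KInv = KInv` — the hypothesis `hAr` of
`KernelPermutation.hessKer_perm` ∕ `permCovariant_hessKer` for the typed `U = 1` one-step system, every axis permutation `σ`, every blocking
factor `N ≥ 1`, any dimension. -/
theorem permK_KInv (σ : Equiv.Perm (Fin (d + 1))) : permK (axisPerm σ) (KInv (N := N) (d := d)) = KInv (N := N) := by
  funext x y a b
  rw [permK_axisPerm_apply]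
  rcases a with κ | κ <;> rcases b with l | l
  · -- field–field: `Γ`
    simp only [axisPerm_π_inl, KInv_inl_inl]
    exact Gam_psite σ κ l x y
  · -- field–multiplier: `wH`
    simp only [axisPerm_π_inl, axisPerm_π_inr]
    by_cases hy : Torus.proj N y = 0
    · obtain ⟨q, rfl⟩ : ∃ q, y = (N : ℤ) • q := ⟨_, eq_zsmul_quo_of_proj hy⟩
      rw [psite_smul, KInv_inl_inr_coarse, KInv_inl_inr_coarse, ← psite_smul, ← psite_sub]
      exact wH_psite σ κ l _
    · have hy' : Torus.proj N (psite σ y) ≠ 0 := fun h => hy ((proj_psite_eq_zero_iff σ N y).1 h)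
      rw [KInv_inl_inr_off hy', KInv_inl_inr_off hy]
  · -- multiplier–field: `GamΦ`
    simp only [axisPerm_π_inl, axisPerm_π_inr]
    by_cases hx : Torus.proj N x = 0
    · obtain ⟨q, rfl⟩ : ∃ q, x = (N : ℤ) • q := ⟨_, eq_zsmul_quo_of_proj hx⟩
      rw [psite_smul, KInv_inr_inl_coarse, KInv_inr_inl_coarse]
      exact GamΦ_psite σ κ l q y
    · have hx' : Torus.proj N (psite σ x) ≠ 0 := fun h => hx ((proj_psite_eq_zero_iff σ N x).1 h)
      rw [KInv_inr_off hx', KInv_inr_off hx]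
  · -- multiplier–multiplier: `wΦ`
    simp only [axisPerm_π_inr]
    by_cases hx : Torus.proj N x = 0
    · obtain ⟨q, rfl⟩ : ∃ q, x = (N : ℤ) • q := ⟨_, eq_zsmul_quo_of_proj hx⟩
      by_cases hy : Torus.proj N y = 0
      · obtain ⟨q', rfl⟩ : ∃ q', y = (N : ℤ) • q' := ⟨_, eq_zsmul_quo_of_proj hy⟩
        rw [psite_smul, psite_smul, KInv_inr_inr_coarse, KInv_inr_inr_coarse, ← psite_sub]
        exact wΦ_psite σ κ l _
      · have hy' : Torus.proj N (psite σ y) ≠ 0 := fun h => hy ((proj_psite_eq_zero_iff σ N y).1 h)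
        have e1 : KInv (N := N) (psite σ ((N : ℤ) • q)) (psite σ y) (Sum.inr (σ κ)) (Sum.inr (σ l)) = 0 := by
          simp only [KInv, hy', and_false, if_false]
        have e2 : KInv (N := N) ((N : ℤ) • q) y (Sum.inr κ) (Sum.inr l) = 0 := by
          simp only [KInv, hy, and_false, if_false]
        rw [e1, e2]
    · have hx' : Torus.proj N (psite σ x) ≠ 0 := fun h => hx ((proj_psite_eq_zero_iff σ N x).1 h)
      rw [KInv_inr_off hx', KInv_inr_off hx]

end Resolvent

end

end Summit.QuantumFields.BalabanUV.Beta.ResolventPermutation
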